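import Summits.QuantumFields.BalabanUV.T4Continuum.Spine.NE9.TowerCarriersBox

/-!
# Spine/NE5/TowerFromPairs — row NE5 (node U3) ↔ row NE9 (C27): ne9's `TowerCarriers.TowerNE5` FROM a family of PER-PAIR
# `T4OutputRate.NE5` statements read through PAIR READINGS, plus the finer run's NEWBORN-term levels — the located typing point
# between the two rows' shapes, BY NAME

Cell `pub-balaban-gaps` (YM blitz Y1, track G2), seat `ne5` gen 4 (`prover-pub-balaban-gaps-ne5-g4-0`), triage sheet `HOME/ne/NE5.md`
v4 §5 T7 ∕ §7 (x3).  Imports `Spine/NE9/TowerCarriersBox` (seat ne9: gen 4's tower of carriers `TowerData` with `TowerNE5` = `T4OutputRate.NE5`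
at every pair of consecutive run lengths, run `k+1`'s unpaired bare coupling prepended, window `]0, γ]`; gen 5's `TowerNE5On T E I` = the same
over an arbitrary coupling box `BoxWindow I`, `towerNE5On_Ioc_iff`); consumer only; modifies nothing.

WHY.  Row NE5's ENDs of record (`B13StepEndInsOp.ne5_of_record_insOp`, `Spine/NE5/EnvelopeOnRecord.ne5_of_leaves_fibre_activities_record`, …)
conclude `T4OutputRate.NE5 EA EB W κ θ′ C₅` on the carriers `B13Carriers.TwoRuns.carriers R` of ONE pair of runs (`R.K`, `R.K + 1`) with
PER-RUN background classes (`BgA = ↥R.admA`, `BgB = ↥R.admB`) and PAIRED domains only (run B's step `j+1` ↔ run A's step `j`; run B's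
step-`0` terms have no partner, GAPS G-t4-U3-5), while nodes U2∕U3 → U6 consume ne9's `TowerNE5 T E γ κ θ C₅`: ONE physical domain type
(`scale X = k − r X` at level `k`, truncated), ONE ambient background type (`BgA = BgB = T.B`, transports `T.tr k`), ONE family `E k` of
functionals of the FULL re-indexed history, run `k+1`'s bare coupling PREPENDED (`E (k+1) (prepend b g)`, every `b ∈ ]0, γ]`), quantified
over ALL ambient backgrounds and ALL physical domains — including those NOT YET BORN in run `k`.  This file names what an instancer owes to
pass from the former to the latter and proves the passage:
* `PairReading T E k` (§1): pair carriers `C`; the run-`(k+1)` backgrounds `admU ⊆ T.B` inside the ambient type with `bgB : T.B → C.BgB` and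
  `dom : T.Dom → C.Dom` not lowering scale ∕ tree length on the domains present in run `k` (`r X ≤ k`); a pair `(EA, EB b)` of functionals
  on `C`; the READING identities on `admU` × {`r X ≤ k`} (`E k g (T.tr k U) X = EA g (C.transport (bgB U)) (dom X)`,
  `E (k+1) (prepend b g) U X = EB b g (bgB U) (dom X)`); and the VANISHING CONVENTIONS — both tower values vanish off `admU` (the
  disjoint-union-with-junk convention for per-run classes) and at domains not yet born (`k < r X` in run `k`, `k+1 < r X` in run `k+1`);
* `towerNE5On_of_pairReadings` (§2): per-pair `NE5 (EA k) (EB k b) (BoxWindow I) κ θ C₅` for every `k` and `b ∈ I` with ONE tuple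
  `(κ, θ, C₅)` (K-UNIFORM letters, `κ ≥ 0`, `0 ≤ θ ≤ 1`) AND the LEVEL bound `|E (k+1) (prepend b g) U X| ≤ C₅·e^{−κ d(X)}` of run `k+1`'s
  NEWBORN terms (`r X = k+1`: scale `0` in run `k+1`, absent from run `k`, tower exponent `k − r X = 0`) ⟹ `TowerNE5On T E I κ θ C₅` (any
  coupling box `I`; `towerNE5_of_pairReadings`: the window `]0, γ]`, i.e. gen 4's `TowerNE5`) — so tower-NE5 = per-pair NE5 + the finer run's
  scale-0 levels (`E₀ ≤ C₅`) + conventions, and nothing more;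
* `gluing_of_pairReadings` (§2): on transported backgrounds the readings FORCE «level `k`'s B-side functional = level `k+1`'s A-side functional
  at the prepended history» — the one consistency an instancer building `E` from per-pair data must arrange; `pairBound_of_towerNE5` (§2): the
  converse — tower-NE5 (over any box) returns the per-pair comparison on the readings' images with the tower's exponents (the junction is tight).
Nothing is instantiated: carriers, classes, maps and functionals are PARAMETERS (for Bałaban's paired tori: `T.B := (Σ K, admB K) ⊕ junk`,
`T.tr k` := one block averaging on the `(k+1)`-component and `↦ junk` elsewhere, `EB_K g := E^B (prepend b g)` with `b`-uniform letters —
`ne/NE5.md` §7 (x3); candidate instance file `Spine/NE5/TowerFromRecord.lean` once NODE O fixes `admB`).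

HONEST FRAMING.  Bookkeeping BY NAME between two typed hypothesis SHAPES; zero classification weight; nothing of Bałaban's constructed or
asserted; NE5 ∕ tower-NE5 NOT PRINTED (cell estimates; print has only the uniformity in the lattice spacing, [Balaban1987RG1] Thm 1
p. 259) and NOT PROVED; 0∕12 leaves; spine PROVED 0∕9; rung (B)+1 on a FIXED finite T⁴ — NOT the continuum limit, NOT infinite volume,
NOT a mass gap, NOT Clay.  HONEST DEPENDENCY: continuum YM on T⁴ ⇐ BetaPertH ∧ nine spine estimates (0/9 proved); BetaPertH ⇐ (D1) ∧ (D4)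
∧ CAP+tail.  0 sorry; axioms standard; no cite tags (nothing printed is asserted).
-/

namespace Summit.QuantumFields.BalabanUV.T4Continuum.Spine.NE5.TowerFromPairs

open Literature.MathematicalPhysics.QuantumFieldTheory.Balaban1983to89
open Literature.MathematicalPhysics.QuantumFieldTheory.Balaban1983to89.T4OutputRate
open Literature.MathematicalPhysics.QuantumFieldTheory.Balaban1983to89.T4CouplingAnalyticity (BoxWindow window_eq_boxWindow)
open Summit.QuantumFields.BalabanUV.T4Continuum.NE9.TowerCarriers
open Summit.QuantumFields.BalabanUV.T4Continuum.NE9.TowerCarriersBox (TowerNE5On towerNE5On_Ioc_iff)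

/-! ## §1 Pair readings of a tower functional -/

/-- **PAIR READING** of the tower functional `E` at level `k` (runs `k`, `k+1`) through PAIR CARRIERS `C` (e.g. row NE5's carriers of
record for run length `k`): the run-`(k+1)` backgrounds `admU` inside the ambient type, the maps `bgB`, `dom` (not lowering scale ∕ tree
length on the domains present in run `k`), a pair of functionals on `C` (B-side indexed by run `k+1`'s unpaired bare coupling), the two
reading identities on `admU` × {`r X ≤ k`}, and the vanishing conventions off `admU` and at unborn domains.  DATA + identities an
instancer supplies; nothing asserted. [folklore] -/
structure PairReading (T : TowerData) (E : ℕ → (ℕ → ℝ) → T.B → T.Dom → ℝ) (k : ℕ) where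
  /-- the pair carriers of runs `k`, `k+1` -/
  C : Carriers
  /-- run `k+1`'s backgrounds inside the ambient background type -/
  admU : Set T.B
  /-- physical domain ↦ pair-carrier domain -/
  dom : T.Dom → C.Dom
  /-- ambient background ↦ run-B background of the pair carriers -/
  bgB : T.B → C.BgB
  /-- run A's functional on the pair carriers -/
  EA : Functional C C.BgA
  /-- run B's functional on the pair carriers, for each value of its unpaired bare coupling -/
  EB : ℝ → Functional C C.BgB
  /-- on domains present in run `k`, the pair carriers' scale is at least the tower scale `k − r X` -/
  scale_le : ∀ X, T.r X ≤ k → k - T.r X ≤ C.scale (dom X)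
  /-- on domains present in run `k`, the pair carriers' tree length dominates the tower's -/
  d_le : ∀ X, T.r X ≤ k → T.d X ≤ C.d (dom X)
  /-- READING A: at a transported run-`(k+1)` background and a domain present in run `k`, the level-`k` tower functional is run A's
  functional at the pair carriers' transported background -/
  readA : ∀ (g : ℕ → ℝ), ∀ U ∈ admU, ∀ X, T.r X ≤ k → E k g (T.tr k U) X = EA g (C.transport (bgB U)) (dom X)
  /-- READING B: at a run-`(k+1)` background and a domain present in run `k`, the level-`(k+1)` tower functional at a prepended history
  is run B's functional -/
  readB : ∀ (b : ℝ) (g : ℕ → ℝ), ∀ U ∈ admU, ∀ X, T.r X ≤ k → E (k + 1) (prepend b g) U X = EB b g (bgB U) (dom X)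
  /-- CONVENTION: off run `k+1`'s class both tower values vanish (junk ∕ foreign components of the ambient type) -/
  offU : ∀ (g g' : ℕ → ℝ), ∀ U ∉ admU, ∀ X, E k g (T.tr k U) X = 0 ∧ E (k + 1) g' U X = 0
  /-- CONVENTION: a domain not yet born in run `k` carries no run-`k` term -/
  unbornA : ∀ (g : ℕ → ℝ) (V : T.B) (X : T.Dom), k < T.r X → E k g V X = 0
  /-- CONVENTION: a domain not yet born in run `k+1` carries no run-`(k+1)` term -/
  unbornB : ∀ (g : ℕ → ℝ) (U : T.B) (X : T.Dom), k + 1 < T.r X → E (k + 1) g U X = 0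

/-! ## §2 The junction -/

variable {T : TowerData} {E : ℕ → (ℕ → ℝ) → T.B → T.Dom → ℝ}

/-- [folklore] Monotonicity of the NE5 majorant: a larger scale exponent (`0 ≤ θ ≤ 1`) and a larger tree length (`κ ≥ 0`) give a
smaller bound. -/
theorem majorant_mono {κ θ C₅ : ℝ} (hκ : 0 ≤ κ) (hθ0 : 0 ≤ θ) (hθ1 : θ ≤ 1) (hC : 0 ≤ C₅) {s s' : ℕ} (hs : s ≤ s')
    {d d' : ℝ} (hd : d ≤ d') :
    C₅ * θ ^ s' * Real.exp (-(κ * d')) ≤ C₅ * θ ^ s * Real.exp (-(κ * d)) :=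
  mul_le_mul (mul_le_mul_of_nonneg_left (pow_le_pow_of_le_one hθ0 hθ1 hs) hC)
    (Real.exp_le_exp.2 (neg_le_neg (mul_le_mul_of_nonneg_left hd hκ))) (Real.exp_pos _).le
    (mul_nonneg hC (pow_nonneg hθ0 _))

/-- **TOWER-NE5 (OVER ANY COUPLING BOX) FROM PER-PAIR NE5 + NEWBORN LEVELS.**  If every level `k` of the tower has a pair reading, if
for every `k` and every unpaired coupling `b ∈ I` `T4OutputRate.NE5 (EA k) (EB k b) (BoxWindow I) κ θ C₅` holds on the pair carriers with
ONE tuple `(κ, θ, C₅)` (`κ ≥ 0`, `0 ≤ θ ≤ 1`, `C₅ ≥ 0`), and if run `k+1`'s NEWBORN terms (domains with `r X = k+1`, unpaired) obey the level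
bound `|E (k+1) (prepend b g) U X| ≤ C₅·e^{−κ d(X)}` on run `k+1`'s class, then ne9's `TowerNE5On T E I κ θ C₅`. [folklore] -/
theorem towerNE5On_of_pairReadings (P : ∀ k, PairReading T E k) {I : Set ℝ} {κ θ C₅ : ℝ} (hκ : 0 ≤ κ) (hθ0 : 0 ≤ θ)
    (hθ1 : θ ≤ 1) (hC : 0 ≤ C₅) (h5 : ∀ k, ∀ b ∈ I, NE5 (P k).EA ((P k).EB b) (BoxWindow I) κ θ C₅)
    (hnew : ∀ k, ∀ b ∈ I, ∀ g ∈ BoxWindow I, ∀ U ∈ (P k).admU, ∀ X : T.Dom, T.r X = k + 1 →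
      |E (k + 1) (prepend b g) U X| ≤ C₅ * Real.exp (-(κ * T.d X))) :
    TowerNE5On T E I κ θ C₅ := by
  intro k b hb g hg U X
  change |E k g (T.tr k U) X - E (k + 1) (prepend b g) U X| ≤ C₅ * θ ^ (k - T.r X) * Real.exp (-(κ * T.d X))
  have hRHS : 0 ≤ C₅ * θ ^ (k - T.r X) * Real.exp (-(κ * T.d X)) :=
    mul_nonneg (mul_nonneg hC (pow_nonneg hθ0 _)) (Real.exp_pos _).le
  by_cases hU : U ∈ (P k).admU
  · rcases le_or_gt (T.r X) k with hX | hX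
    · -- a domain present in run `k`: the paired comparison, read through the pair carriers
      rw [(P k).readA g U hU X hX, (P k).readB b g U hU X hX]
      exact (h5 k b hb g hg ((P k).bgB U) ((P k).dom X)).trans
        (majorant_mono hκ hθ0 hθ1 hC ((P k).scale_le X hX) ((P k).d_le X hX))
    · rw [(P k).unbornA g _ X hX, zero_sub, abs_neg]
      rcases (Nat.succ_le_of_lt hX).eq_or_lt with hX' | hX'
      · -- a domain newborn in run `k+1`: its scale-0 level, tower exponent `k − r X = 0`
        rw [Nat.sub_eq_zero_of_le hX.le, pow_zero, mul_one]
        exact hnew k b hb g hg U hU X hX'.symm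
      · -- not yet born in run `k+1` either
        rw [(P k).unbornB _ U X hX', abs_zero]
        exact hRHS
  · -- off run `k+1`'s class both sides vanish by convention
    obtain ⟨h0, h1⟩ := (P k).offU g (prepend b g) U hU X
    rw [h0, h1, sub_zero, abs_zero]
    exact hRHS

/-- **THE WINDOW `]0, γ]`** (gen 4's `TowerNE5`): per-pair NE5 on `Window γ` for every `b ∈ ]0, γ]` + newborn levels ⟹ `TowerNE5 T E γ κ θ C₅`
(`Window γ = BoxWindow ]0, γ]` by `rfl`, `towerNE5On_Ioc_iff`). [folklore] -/
theorem towerNE5_of_pairReadings (P : ∀ k, PairReading T E k) {γ κ θ C₅ : ℝ} (hκ : 0 ≤ κ) (hθ0 : 0 ≤ θ) (hθ1 : θ ≤ 1)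
    (hC : 0 ≤ C₅) (h5 : ∀ k (b : ℝ), 0 < b → b ≤ γ → NE5 (P k).EA ((P k).EB b) (Window γ) κ θ C₅)
    (hnew : ∀ k (b : ℝ), 0 < b → b ≤ γ → ∀ g ∈ Window γ, ∀ U ∈ (P k).admU, ∀ X : T.Dom, T.r X = k + 1 →
      |E (k + 1) (prepend b g) U X| ≤ C₅ * Real.exp (-(κ * T.d X))) :
    TowerNE5 T E γ κ θ C₅ :=
  (towerNE5On_Ioc_iff T).1 (towerNE5On_of_pairReadings P hκ hθ0 hθ1 hC (fun k b hb => h5 k b hb.1 hb.2)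
    (fun k b hb g hg => hnew k b hb.1 hb.2 g hg))

/-- **THE GLUING IDENTITY THE READINGS FORCE** (what an instancer building `E` from per-pair functionals must arrange): at a run-`(k+2)`
background `U'` whose transport lies in run `k+1`'s class and a domain present in run `k`, level `k`'s B-side functional read through level
`k`'s maps IS level `k+1`'s A-side functional at the prepended history read through level `k+1`'s maps. [folklore] -/
theorem gluing_of_pairReadings (P : ∀ k, PairReading T E k) (k : ℕ) (b : ℝ) (g : ℕ → ℝ) {U' : T.B}
    (hU' : U' ∈ (P (k + 1)).admU) (hU : T.tr (k + 1) U' ∈ (P k).admU) {X : T.Dom} (hX : T.r X ≤ k) :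
    (P k).EB b g ((P k).bgB (T.tr (k + 1) U')) ((P k).dom X) =
      (P (k + 1)).EA (prepend b g) ((P (k + 1)).C.transport ((P (k + 1)).bgB U')) ((P (k + 1)).dom X) := by
  rw [← (P k).readB b g _ hU X hX, (P (k + 1)).readA (prepend b g) U' hU' X (hX.trans (Nat.le_succ k))]

/-- **CONVERSELY — the junction is tight**: tower-NE5 gives back, on the image of each pair reading, the per-pair comparison with the
tower's exponents — at a run-`(k+1)` background in the class and a domain present in run `k`,
`|EA g (C.transport (bgB U)) (dom X) − EB b g (bgB U) (dom X)| ≤ C₅·θ^{k − r X}·e^{−κ d(X)}`; so, up to the maps' images and the newborn ∕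
vanishing conventions, tower-NE5 and per-pair NE5 with uniform letters are the SAME requirement. [folklore] -/
theorem pairBound_of_towerNE5On (P : ∀ k, PairReading T E k) {I : Set ℝ} {κ θ C₅ : ℝ} (h : TowerNE5On T E I κ θ C₅) (k : ℕ)
    {b : ℝ} (hb : b ∈ I) {g : ℕ → ℝ} (hg : g ∈ BoxWindow I) {U : T.B} (hU : U ∈ (P k).admU) {X : T.Dom} (hX : T.r X ≤ k) :
    |(P k).EA g ((P k).C.transport ((P k).bgB U)) ((P k).dom X) - (P k).EB b g ((P k).bgB U) ((P k).dom X)| ≤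
      C₅ * θ ^ (k - T.r X) * Real.exp (-(κ * T.d X)) := by
  rw [← (P k).readA g U hU X hX, ← (P k).readB b g U hU X hX]
  exact h k b hb g hg U X

/-- [folklore] The same over the window `]0, γ]` (gen 4's `TowerNE5`). -/
theorem pairBound_of_towerNE5 (P : ∀ k, PairReading T E k) {γ κ θ C₅ : ℝ} (h : TowerNE5 T E γ κ θ C₅) (k : ℕ) {b : ℝ}
    (hb : 0 < b) (hbγ : b ≤ γ) {g : ℕ → ℝ} (hg : g ∈ Window γ) {U : T.B} (hU : U ∈ (P k).admU) {X : T.Dom} (hX : T.r X ≤ k) :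
    |(P k).EA g ((P k).C.transport ((P k).bgB U)) ((P k).dom X) - (P k).EB b g ((P k).bgB U) ((P k).dom X)| ≤
      C₅ * θ ^ (k - T.r X) * Real.exp (-(κ * T.d X)) :=
  pairBound_of_towerNE5On P ((towerNE5On_Ioc_iff T).2 h) k ⟨hb, hbγ⟩ (by rwa [window_eq_boxWindow] at hg) hU hX

/-- [folklore] What per-pair NE5 does NOT see: the tower's comparison at a domain NEWBORN in run `k+1` is the bare scale-0 term of run
`k+1` against `0` — exactly the extra input `hnew` of `towerNE5_of_pairReadings` (run B's unpaired step-0 terms, GAPS G-t4-U3-5). -/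
theorem tower_term_newborn (P : ∀ k, PairReading T E k) (k : ℕ) (b : ℝ) (g : ℕ → ℝ) (U : T.B) {X : T.Dom} (hX : T.r X = k + 1) :
    E k g (T.tr k U) X - E (k + 1) (prepend b g) U X = -E (k + 1) (prepend b g) U X := by
  rw [(P k).unbornA g _ X (by omega), zero_sub]

end Summit.QuantumFields.BalabanUV.T4Continuum.Spine.NE5.TowerFromPairs
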